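import Summits.RiemannHypothesis.RiemannHypothesis.Theorems.WeilFormatCDataO94TabValid1
import Summits.RiemannHypothesis.RiemannHypothesis.Theorems.WeilFormatCDataO94TabValid2
import Summits.RiemannHypothesis.RiemannHypothesis.Theorems.WeilFormatCDataO94TabValid3
import Summits.RiemannHypothesis.RiemannHypothesis.Theorems.WeilFormatCDataO94TabValid4
import Summits.RiemannHypothesis.RiemannHypothesis.Theorems.WeilFormatCDataO94TabValid
import Summits.RiemannHypothesis.RiemannHypothesis.Theorems.WeilFormatCDataO94ColSlice0
import Summits.RiemannHypothesis.RiemannHypothesis.Theorems.WeilFormatCDataO94ColSlice1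
import Summits.RiemannHypothesis.RiemannHypothesis.Theorems.WeilFormatCDataO94ColSlice2
import Summits.RiemannHypothesis.RiemannHypothesis.Theorems.WeilFormatCDataO94ColSlice3
import Summits.RiemannHypothesis.RiemannHypothesis.Theorems.WeilFormatCDataO94ColSlice4
import Summits.RiemannHypothesis.RiemannHypothesis.Theorems.WeilFormatCDataO94ColSlice5B
import Summits.RiemannHypothesis.RiemannHypothesis.Theorems.WeilFormatCDataO94ColSlice6B
import Summits.RiemannHypothesis.RiemannHypothesis.Theorems.WeilFormatCDataO94ColSlice7B
import Summits.RiemannHypothesis.RiemannHypothesis.Theorems.WeilFormatCDataO94ColSlice8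
import Summits.RiemannHypothesis.RiemannHypothesis.Theorems.WeilFormatCDataO94ColSlice9
import Summits.RiemannHypothesis.RiemannHypothesis.Theorems.WeilFormatCDataO94ColSlice10
import Summits.RiemannHypothesis.RiemannHypothesis.Theorems.WeilFormatCDataO94ColSlice11
import Summits.RiemannHypothesis.RiemannHypothesis.Theorems.WeilFormatCDataO94ColSlice12
import Summits.RiemannHypothesis.RiemannHypothesis.Theorems.WeilFormatCDataO94ColSlice13
import Summits.RiemannHypothesis.RiemannHypothesis.Theorems.WeilFormatCDataO94ColSlice14
import Summits.RiemannHypothesis.RiemannHypothesis.Theorems.WeilFormatCDataO94FrontB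
import Summits.RiemannHypothesis.RiemannHypothesis.Theorems.WeilFormatCDataO94FrontW1
import Summits.RiemannHypothesis.RiemannHypothesis.Theorems.WeilFormatCDataO94FrontW2
import Summits.RiemannHypothesis.RiemannHypothesis.Theorems.WeilFormatCDataA1RungCB
import Summits.RiemannHypothesis.RiemannHypothesis.Theorems.WeilFormatCDataO94Mid
import Summits.RiemannHypothesis.RiemannHypothesis.Theorems.WeilFormatCDataO94CBOddCols0
import Summits.RiemannHypothesis.RiemannHypothesis.Theorems.WeilFormatCDataO94CBOddCols1
import Summits.RiemannHypothesis.RiemannHypothesis.Theorems.WeilFormatCDataO94CBOddCols2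
import Summits.RiemannHypothesis.RiemannHypothesis.Theorems.WeilFormatCDataO94CBOddCols3
import Summits.RiemannHypothesis.RiemannHypothesis.Theorems.WeilFormatCDataO94CBOddCols4
import Summits.RiemannHypothesis.RiemannHypothesis.Theorems.WeilFormatCDataO94CBOddTailPsi0B
import Summits.RiemannHypothesis.RiemannHypothesis.Theorems.WeilFormatCDataO94CBOddTail
import Summits.RiemannHypothesis.RiemannHypothesis.Theorems.WeilFormatCDataO94CBOddSchur0
import Summits.RiemannHypothesis.RiemannHypothesis.Theorems.WeilFormatCDataO94CBOddSchur1
import Summits.RiemannHypothesis.RiemannHypothesis.Theorems.WeilFormatCDataO94CBOddSchur2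
import Summits.RiemannHypothesis.RiemannHypothesis.Theorems.WeilFormatCDataO94CBOddSchur3
import Summits.RiemannHypothesis.RiemannHypothesis.Theorems.WeilFormatCDataO94CBOddSchur4
import Summits.RiemannHypothesis.RiemannHypothesis.Theorems.WeilFormatCDataO94CBOddSchur5
import Summits.RiemannHypothesis.RiemannHypothesis.Theorems.WeilFormatCDataO94CBOddSchur6
import Summits.RiemannHypothesis.RiemannHypothesis.Theorems.WeilFormatCDataO94CBOddSchur7
import Summits.RiemannHypothesis.RiemannHypothesis.Theorems.WeilFormatCDataO94CBOddSchur8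
import Summits.RiemannHypothesis.RiemannHypothesis.Theorems.WeilFormatCDataO94CBOddSchur9
import Summits.RiemannHypothesis.RiemannHypothesis.Theorems.WeilFormatCDataO94CBOddSchur10
import Summits.RiemannHypothesis.RiemannHypothesis.Theorems.WeilFormatCDataO94CBOddSchur11
import Summits.RiemannHypothesis.RiemannHypothesis.Theorems.WeilFormatCDataO94CBOddSchur12
import Summits.RiemannHypothesis.RiemannHypothesis.Theorems.WeilFormatCDataO94CBOddSchur13
import Summits.RiemannHypothesis.RiemannHypothesis.Theorems.WeilFormatCDataO94CBOddSchur14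
import Summits.RiemannHypothesis.RiemannHypothesis.Theorems.WeilFormatCDataO94CBOddSchur15
import Summits.RiemannHypothesis.RiemannHypothesis.Theorems.WeilFormatCDataO94CBOddSchur16
import Summits.RiemannHypothesis.RiemannHypothesis.Theorems.WeilFormatCDataO94CBOddPsd0
import Summits.RiemannHypothesis.RiemannHypothesis.Theorems.WeilFormatCDataO94CBOddPsd1
import Summits.RiemannHypothesis.RiemannHypothesis.Theorems.WeilFormatCDataO94CBOddPsd2
import Summits.RiemannHypothesis.RiemannHypothesis.Theorems.WeilFormatCDataO94CBOddPsd3B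
import Summits.RiemannHypothesis.RiemannHypothesis.Theorems.S2FormatCE0
import Literature.NumberTheory.LFunctions.YoshidaWindowGramTailMSSines
import Literature.NumberTheory.LFunctions.YoshidaWindowGramMiddleJBox
import Literature.NumberTheory.LFunctions.YoshidaWindowGramTailJFactoredScaled
import Literature.NumberTheory.LFunctions.YoshidaWindowGramTailMSFactored
import Literature.NumberTheory.LFunctions.YoshidaWindowGramTailJDiagTight
import Summits.RiemannHypothesis.RiemannHypothesis.Theorems.FormatCPsdBands
import Summits.RiemannHypothesis.RiemannHypothesis.Theorems.WeilFormatCDiagShift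
import HarnessLib
import Summits.RiemannHypothesis.RiemannHypothesis.Theorems.WeilFormatCDataO94OddAsmB

/-!
# Format C kernel rung `O94` (a = 47/50, column-band layout): ASSEMBLY of the flat layout, part C of 5 (ladders of ColSlice14, Front, Mid, CBOddCols0, CBOddCols1; split of the 1286-line assembly at block boundaries by prover B g18 for the 400-line cap; blocks byte-identical): every propositional ladder of the kernel files (table/column validity, front door, sines, middle moments, column data, tail factors, Schur rows, (P) + diagonal shift), byte-identical statements and proofs, original order (A g22 restage_flat.py; weil-2 KERNEL-CHAIN-RULES #1)

Window `a = 47/50`; prime powers in the window: 2, 3, 2^2, 5; prime constant A = 1825/1000 (`WeilFormatC.primeCoeff_form_ge_cells_09729`); evaluator parameters S = 2^256, Kpi 130, Kser 150, kred 8, Kexp 45, J 120; full table modes < 161; light column table modes < 1027; units 2^-250 (Schur entries), 2^-124 (column digits, width 127), 2^-118 (tail-factor digits, width 121), 2^-64 (reciprocal weights), 2^-40 (tail base); order-J tail J = 4, θ = 1/2048, η = 1/10 | 4/1.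
Design row: sr-gb-rung-a odd λ-run (parity cell 10 L-side): a = 47/50, μ = 2^-75, odd 160/320/1024, MS tail; see HOME(A)/LADDER-LSIDES-FORMATC-A-g22.md. Generated by sr-gb-rung-a prover A g22 with rh-explicit-weil-2 gen7's generator extended for the odd λ-run (--sector odd --mu-log2; HOME(A)/code-g22/gen7/gramgen7.py sha16 172ee47dc0b1c923) from `#eval` of the tree's `Encl` functions; every datum is re-verified by the kernel in the theorem files (`decide +kernel`). Helper data of the rh-explicit Weil-positivity programme (format C, K-CELL-2), RH-free. [cite: Yoshida1992HermitianForms, §5 (5.15)-(5.16) p. 301; §7 pp. 305–312]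
-/

set_option linter.dupNamespace false
set_option maxRecDepth 200000

-- ===== from WeilFormatCDataO94ColSlice14 =====
namespace Summit.RiemannHypothesis.RiemannHypothesis.Theorems.WeilFormatCData.O94
open Literature.NumberTheory.LFunctions Literature.NumberTheory.LFunctions.Yoshida1992 Encl Literature.Analysis.ValidatedNumerics.NumericsMP

/-- the light column table is valid on `[160, 1027)`. -/
theorem ctab_valid : TabColValid (2 ^ 256) O94.a O94.ks 160 1027 O94.ctab := by
  have h160 : TabColValid (2 ^ 256) a ks 160 160 ctab := TabColValid.empty
  have h170 : TabColValid (2 ^ 256) a ks 160 (160 + 10) ctab :=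
    h160.extend fun m hm hmk ↦ colValid_of_checkTableCol (prm := prm) (by norm_num [prm]) (not_not.mp a_posb) (not_not.mp consts_validb) tC160 hm hmk
  have h180 : TabColValid (2 ^ 256) a ks 160 (170 + 10) ctab :=
    h170.extend fun m hm hmk ↦ colValid_of_checkTableCol (prm := prm) (by norm_num [prm]) (not_not.mp a_posb) (not_not.mp consts_validb) tC170 hm hmk
  have h190 : TabColValid (2 ^ 256) a ks 160 (180 + 10) ctab :=
    h180.extend fun m hm hmk ↦ colValid_of_checkTableCol (prm := prm) (by norm_num [prm]) (not_not.mp a_posb) (not_not.mp consts_validb) tC180 hm hmk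
  have h200 : TabColValid (2 ^ 256) a ks 160 (190 + 10) ctab :=
    h190.extend fun m hm hmk ↦ colValid_of_checkTableCol (prm := prm) (by norm_num [prm]) (not_not.mp a_posb) (not_not.mp consts_validb) tC190 hm hmk
  have h210 : TabColValid (2 ^ 256) a ks 160 (200 + 10) ctab :=
    h200.extend fun m hm hmk ↦ colValid_of_checkTableCol (prm := prm) (by norm_num [prm]) (not_not.mp a_posb) (not_not.mp consts_validb) tC200 hm hmk
  have h220 : TabColValid (2 ^ 256) a ks 160 (210 + 10) ctab :=
    h210.extend fun m hm hmk ↦ colValid_of_checkTableCol (prm := prm) (by norm_num [prm]) (not_not.mp a_posb) (not_not.mp consts_validb) tC210 hm hmk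
  have h230 : TabColValid (2 ^ 256) a ks 160 (220 + 10) ctab :=
    h220.extend fun m hm hmk ↦ colValid_of_checkTableCol (prm := prm) (by norm_num [prm]) (not_not.mp a_posb) (not_not.mp consts_validb) tC220 hm hmk
  have h240 : TabColValid (2 ^ 256) a ks 160 (230 + 10) ctab :=
    h230.extend fun m hm hmk ↦ colValid_of_checkTableCol (prm := prm) (by norm_num [prm]) (not_not.mp a_posb) (not_not.mp consts_validb) tC230 hm hmk
  have h250 : TabColValid (2 ^ 256) a ks 160 (240 + 10) ctab :=
    h240.extend fun m hm hmk ↦ colValid_of_checkTableCol (prm := prm) (by norm_num [prm]) (not_not.mp a_posb) (not_not.mp consts_validb) tC240 hm hmk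
  have h260 : TabColValid (2 ^ 256) a ks 160 (250 + 10) ctab :=
    h250.extend fun m hm hmk ↦ colValid_of_checkTableCol (prm := prm) (by norm_num [prm]) (not_not.mp a_posb) (not_not.mp consts_validb) tC250 hm hmk
  have h270 : TabColValid (2 ^ 256) a ks 160 (260 + 10) ctab :=
    h260.extend fun m hm hmk ↦ colValid_of_checkTableCol (prm := prm) (by norm_num [prm]) (not_not.mp a_posb) (not_not.mp consts_validb) tC260 hm hmk
  have h280 : TabColValid (2 ^ 256) a ks 160 (270 + 10) ctab :=
    h270.extend fun m hm hmk ↦ colValid_of_checkTableCol (prm := prm) (by norm_num [prm]) (not_not.mp a_posb) (not_not.mp consts_validb) tC270 hm hmk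
  have h290 : TabColValid (2 ^ 256) a ks 160 (280 + 10) ctab :=
    h280.extend fun m hm hmk ↦ colValid_of_checkTableCol (prm := prm) (by norm_num [prm]) (not_not.mp a_posb) (not_not.mp consts_validb) tC280 hm hmk
  have h300 : TabColValid (2 ^ 256) a ks 160 (290 + 10) ctab :=
    h290.extend fun m hm hmk ↦ colValid_of_checkTableCol (prm := prm) (by norm_num [prm]) (not_not.mp a_posb) (not_not.mp consts_validb) tC290 hm hmk
  have h310 : TabColValid (2 ^ 256) a ks 160 (300 + 10) ctab :=
    h300.extend fun m hm hmk ↦ colValid_of_checkTableCol (prm := prm) (by norm_num [prm]) (not_not.mp a_posb) (not_not.mp consts_validb) tC300 hm hmk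
  have h320 : TabColValid (2 ^ 256) a ks 160 (310 + 10) ctab :=
    h310.extend fun m hm hmk ↦ colValid_of_checkTableCol (prm := prm) (by norm_num [prm]) (not_not.mp a_posb) (not_not.mp consts_validb) tC310 hm hmk
  have h330 : TabColValid (2 ^ 256) a ks 160 (320 + 10) ctab :=
    h320.extend fun m hm hmk ↦ colValid_of_checkTableCol (prm := prm) (by norm_num [prm]) (not_not.mp a_posb) (not_not.mp consts_validb) tC320 hm hmk
  have h340 : TabColValid (2 ^ 256) a ks 160 (330 + 10) ctab :=
    h330.extend fun m hm hmk ↦ colValid_of_checkTableCol (prm := prm) (by norm_num [prm]) (not_not.mp a_posb) (not_not.mp consts_validb) tC330 hm hmk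
  have h350 : TabColValid (2 ^ 256) a ks 160 (340 + 10) ctab :=
    h340.extend fun m hm hmk ↦ colValid_of_checkTableCol (prm := prm) (by norm_num [prm]) (not_not.mp a_posb) (not_not.mp consts_validb) tC340 hm hmk
  have h360 : TabColValid (2 ^ 256) a ks 160 (350 + 10) ctab :=
    h350.extend fun m hm hmk ↦ colValid_of_checkTableCol (prm := prm) (by norm_num [prm]) (not_not.mp a_posb) (not_not.mp consts_validb) tC350 hm hmk
  have h370 : TabColValid (2 ^ 256) a ks 160 (360 + 10) ctab :=
    h360.extend fun m hm hmk ↦ colValid_of_checkTableCol (prm := prm) (by norm_num [prm]) (not_not.mp a_posb) (not_not.mp consts_validb) tC360 hm hmk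
  have h380 : TabColValid (2 ^ 256) a ks 160 (370 + 10) ctab :=
    h370.extend fun m hm hmk ↦ colValid_of_checkTableCol (prm := prm) (by norm_num [prm]) (not_not.mp a_posb) (not_not.mp consts_validb) tC370 hm hmk
  have h390 : TabColValid (2 ^ 256) a ks 160 (380 + 10) ctab :=
    h380.extend fun m hm hmk ↦ colValid_of_checkTableCol (prm := prm) (by norm_num [prm]) (not_not.mp a_posb) (not_not.mp consts_validb) tC380 hm hmk
  have h400 : TabColValid (2 ^ 256) a ks 160 (390 + 10) ctab :=
    h390.extend fun m hm hmk ↦ colValid_of_checkTableCol (prm := prm) (by norm_num [prm]) (not_not.mp a_posb) (not_not.mp consts_validb) tC390 hm hmk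
  have h410 : TabColValid (2 ^ 256) a ks 160 (400 + 10) ctab :=
    h400.extend fun m hm hmk ↦ colValid_of_checkTableCol (prm := prm) (by norm_num [prm]) (not_not.mp a_posb) (not_not.mp consts_validb) tC400 hm hmk
  have h420 : TabColValid (2 ^ 256) a ks 160 (410 + 10) ctab :=
    h410.extend fun m hm hmk ↦ colValid_of_checkTableCol (prm := prm) (by norm_num [prm]) (not_not.mp a_posb) (not_not.mp consts_validb) tC410 hm hmk
  have h430 : TabColValid (2 ^ 256) a ks 160 (420 + 10) ctab :=
    h420.extend fun m hm hmk ↦ colValid_of_checkTableCol (prm := prm) (by norm_num [prm]) (not_not.mp a_posb) (not_not.mp consts_validb) tC420 hm hmk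
  have h440 : TabColValid (2 ^ 256) a ks 160 (430 + 10) ctab :=
    h430.extend fun m hm hmk ↦ colValid_of_checkTableCol (prm := prm) (by norm_num [prm]) (not_not.mp a_posb) (not_not.mp consts_validb) tC430 hm hmk
  have h450 : TabColValid (2 ^ 256) a ks 160 (440 + 10) ctab :=
    h440.extend fun m hm hmk ↦ colValid_of_checkTableCol (prm := prm) (by norm_num [prm]) (not_not.mp a_posb) (not_not.mp consts_validb) tC440 hm hmk
  have h460 : TabColValid (2 ^ 256) a ks 160 (450 + 10) ctab :=
    h450.extend fun m hm hmk ↦ colValid_of_checkTableCol (prm := prm) (by norm_num [prm]) (not_not.mp a_posb) (not_not.mp consts_validb) tC450 hm hmk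
  have h470 : TabColValid (2 ^ 256) a ks 160 (460 + 10) ctab :=
    h460.extend fun m hm hmk ↦ colValid_of_checkTableCol (prm := prm) (by norm_num [prm]) (not_not.mp a_posb) (not_not.mp consts_validb) tC460b.symm hm hmk
  have h480 : TabColValid (2 ^ 256) a ks 160 (470 + 10) ctab :=
    h470.extend fun m hm hmk ↦ colValid_of_checkTableCol (prm := prm) (by norm_num [prm]) (not_not.mp a_posb) (not_not.mp consts_validb) tC470b.symm hm hmk
  have h490 : TabColValid (2 ^ 256) a ks 160 (480 + 10) ctab :=
    h480.extend fun m hm hmk ↦ colValid_of_checkTableCol (prm := prm) (by norm_num [prm]) (not_not.mp a_posb) (not_not.mp consts_validb) tC480b.symm hm hmk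
  have h500 : TabColValid (2 ^ 256) a ks 160 (490 + 10) ctab :=
    h490.extend fun m hm hmk ↦ colValid_of_checkTableCol (prm := prm) (by norm_num [prm]) (not_not.mp a_posb) (not_not.mp consts_validb) tC490b.symm hm hmk
  have h510 : TabColValid (2 ^ 256) a ks 160 (500 + 10) ctab :=
    h500.extend fun m hm hmk ↦ colValid_of_checkTableCol (prm := prm) (by norm_num [prm]) (not_not.mp a_posb) (not_not.mp consts_validb) tC500b.symm hm hmk
  have h520 : TabColValid (2 ^ 256) a ks 160 (510 + 10) ctab :=
    h510.extend fun m hm hmk ↦ colValid_of_checkTableCol (prm := prm) (by norm_num [prm]) (not_not.mp a_posb) (not_not.mp consts_validb) tC510b.symm hm hmk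
  have h530 : TabColValid (2 ^ 256) a ks 160 (520 + 10) ctab :=
    h520.extend fun m hm hmk ↦ colValid_of_checkTableCol (prm := prm) (by norm_num [prm]) (not_not.mp a_posb) (not_not.mp consts_validb) tC520b.symm hm hmk
  have h540 : TabColValid (2 ^ 256) a ks 160 (530 + 10) ctab :=
    h530.extend fun m hm hmk ↦ colValid_of_checkTableCol (prm := prm) (by norm_num [prm]) (not_not.mp a_posb) (not_not.mp consts_validb) tC530b.symm hm hmk
  have h550 : TabColValid (2 ^ 256) a ks 160 (540 + 10) ctab :=
    h540.extend fun m hm hmk ↦ colValid_of_checkTableCol (prm := prm) (by norm_num [prm]) (not_not.mp a_posb) (not_not.mp consts_validb) tC540b.symm hm hmk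
  have h560 : TabColValid (2 ^ 256) a ks 160 (550 + 10) ctab :=
    h550.extend fun m hm hmk ↦ colValid_of_checkTableCol (prm := prm) (by norm_num [prm]) (not_not.mp a_posb) (not_not.mp consts_validb) tC550b.symm hm hmk
  have h570 : TabColValid (2 ^ 256) a ks 160 (560 + 10) ctab :=
    h560.extend fun m hm hmk ↦ colValid_of_checkTableCol (prm := prm) (by norm_num [prm]) (not_not.mp a_posb) (not_not.mp consts_validb) tC560b.symm hm hmk
  have h580 : TabColValid (2 ^ 256) a ks 160 (570 + 10) ctab :=
    h570.extend fun m hm hmk ↦ colValid_of_checkTableCol (prm := prm) (by norm_num [prm]) (not_not.mp a_posb) (not_not.mp consts_validb) tC570b.symm hm hmk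
  have h590 : TabColValid (2 ^ 256) a ks 160 (580 + 10) ctab :=
    h580.extend fun m hm hmk ↦ colValid_of_checkTableCol (prm := prm) (by norm_num [prm]) (not_not.mp a_posb) (not_not.mp consts_validb) tC580b.symm hm hmk
  have h600 : TabColValid (2 ^ 256) a ks 160 (590 + 10) ctab :=
    h590.extend fun m hm hmk ↦ colValid_of_checkTableCol (prm := prm) (by norm_num [prm]) (not_not.mp a_posb) (not_not.mp consts_validb) tC590b.symm hm hmk
  have h610 : TabColValid (2 ^ 256) a ks 160 (600 + 10) ctab :=
    h600.extend fun m hm hmk ↦ colValid_of_checkTableCol (prm := prm) (by norm_num [prm]) (not_not.mp a_posb) (not_not.mp consts_validb) tC600b.symm hm hmk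
  have h620 : TabColValid (2 ^ 256) a ks 160 (610 + 10) ctab :=
    h610.extend fun m hm hmk ↦ colValid_of_checkTableCol (prm := prm) (by norm_num [prm]) (not_not.mp a_posb) (not_not.mp consts_validb) tC610b.symm hm hmk
  have h630 : TabColValid (2 ^ 256) a ks 160 (620 + 10) ctab :=
    h620.extend fun m hm hmk ↦ colValid_of_checkTableCol (prm := prm) (by norm_num [prm]) (not_not.mp a_posb) (not_not.mp consts_validb) tC620b.symm hm hmk
  have h640 : TabColValid (2 ^ 256) a ks 160 (630 + 10) ctab :=
    h630.extend fun m hm hmk ↦ colValid_of_checkTableCol (prm := prm) (by norm_num [prm]) (not_not.mp a_posb) (not_not.mp consts_validb) tC630b.symm hm hmk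
  have h650 : TabColValid (2 ^ 256) a ks 160 (640 + 10) ctab :=
    h640.extend fun m hm hmk ↦ colValid_of_checkTableCol (prm := prm) (by norm_num [prm]) (not_not.mp a_posb) (not_not.mp consts_validb) tC640 hm hmk
  have h660 : TabColValid (2 ^ 256) a ks 160 (650 + 10) ctab :=
    h650.extend fun m hm hmk ↦ colValid_of_checkTableCol (prm := prm) (by norm_num [prm]) (not_not.mp a_posb) (not_not.mp consts_validb) tC650 hm hmk
  have h670 : TabColValid (2 ^ 256) a ks 160 (660 + 10) ctab :=
    h660.extend fun m hm hmk ↦ colValid_of_checkTableCol (prm := prm) (by norm_num [prm]) (not_not.mp a_posb) (not_not.mp consts_validb) tC660 hm hmk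
  have h680 : TabColValid (2 ^ 256) a ks 160 (670 + 10) ctab :=
    h670.extend fun m hm hmk ↦ colValid_of_checkTableCol (prm := prm) (by norm_num [prm]) (not_not.mp a_posb) (not_not.mp consts_validb) tC670 hm hmk
  have h690 : TabColValid (2 ^ 256) a ks 160 (680 + 10) ctab :=
    h680.extend fun m hm hmk ↦ colValid_of_checkTableCol (prm := prm) (by norm_num [prm]) (not_not.mp a_posb) (not_not.mp consts_validb) tC680 hm hmk
  have h700 : TabColValid (2 ^ 256) a ks 160 (690 + 10) ctab :=
    h690.extend fun m hm hmk ↦ colValid_of_checkTableCol (prm := prm) (by norm_num [prm]) (not_not.mp a_posb) (not_not.mp consts_validb) tC690 hm hmk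
  have h710 : TabColValid (2 ^ 256) a ks 160 (700 + 10) ctab :=
    h700.extend fun m hm hmk ↦ colValid_of_checkTableCol (prm := prm) (by norm_num [prm]) (not_not.mp a_posb) (not_not.mp consts_validb) tC700 hm hmk
  have h720 : TabColValid (2 ^ 256) a ks 160 (710 + 10) ctab :=
    h710.extend fun m hm hmk ↦ colValid_of_checkTableCol (prm := prm) (by norm_num [prm]) (not_not.mp a_posb) (not_not.mp consts_validb) tC710 hm hmk
  have h730 : TabColValid (2 ^ 256) a ks 160 (720 + 10) ctab :=
    h720.extend fun m hm hmk ↦ colValid_of_checkTableCol (prm := prm) (by norm_num [prm]) (not_not.mp a_posb) (not_not.mp consts_validb) tC720 hm hmk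
  have h740 : TabColValid (2 ^ 256) a ks 160 (730 + 10) ctab :=
    h730.extend fun m hm hmk ↦ colValid_of_checkTableCol (prm := prm) (by norm_num [prm]) (not_not.mp a_posb) (not_not.mp consts_validb) tC730 hm hmk
  have h750 : TabColValid (2 ^ 256) a ks 160 (740 + 10) ctab :=
    h740.extend fun m hm hmk ↦ colValid_of_checkTableCol (prm := prm) (by norm_num [prm]) (not_not.mp a_posb) (not_not.mp consts_validb) tC740 hm hmk
  have h760 : TabColValid (2 ^ 256) a ks 160 (750 + 10) ctab :=
    h750.extend fun m hm hmk ↦ colValid_of_checkTableCol (prm := prm) (by norm_num [prm]) (not_not.mp a_posb) (not_not.mp consts_validb) tC750 hm hmk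
  have h770 : TabColValid (2 ^ 256) a ks 160 (760 + 10) ctab :=
    h760.extend fun m hm hmk ↦ colValid_of_checkTableCol (prm := prm) (by norm_num [prm]) (not_not.mp a_posb) (not_not.mp consts_validb) tC760 hm hmk
  have h780 : TabColValid (2 ^ 256) a ks 160 (770 + 10) ctab :=
    h770.extend fun m hm hmk ↦ colValid_of_checkTableCol (prm := prm) (by norm_num [prm]) (not_not.mp a_posb) (not_not.mp consts_validb) tC770 hm hmk
  have h790 : TabColValid (2 ^ 256) a ks 160 (780 + 10) ctab :=
    h780.extend fun m hm hmk ↦ colValid_of_checkTableCol (prm := prm) (by norm_num [prm]) (not_not.mp a_posb) (not_not.mp consts_validb) tC780 hm hmk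
  have h800 : TabColValid (2 ^ 256) a ks 160 (790 + 10) ctab :=
    h790.extend fun m hm hmk ↦ colValid_of_checkTableCol (prm := prm) (by norm_num [prm]) (not_not.mp a_posb) (not_not.mp consts_validb) tC790 hm hmk
  have h810 : TabColValid (2 ^ 256) a ks 160 (800 + 10) ctab :=
    h800.extend fun m hm hmk ↦ colValid_of_checkTableCol (prm := prm) (by norm_num [prm]) (not_not.mp a_posb) (not_not.mp consts_validb) tC800 hm hmk
  have h820 : TabColValid (2 ^ 256) a ks 160 (810 + 10) ctab :=
    h810.extend fun m hm hmk ↦ colValid_of_checkTableCol (prm := prm) (by norm_num [prm]) (not_not.mp a_posb) (not_not.mp consts_validb) tC810 hm hmk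
  have h830 : TabColValid (2 ^ 256) a ks 160 (820 + 10) ctab :=
    h820.extend fun m hm hmk ↦ colValid_of_checkTableCol (prm := prm) (by norm_num [prm]) (not_not.mp a_posb) (not_not.mp consts_validb) tC820 hm hmk
  have h840 : TabColValid (2 ^ 256) a ks 160 (830 + 10) ctab :=
    h830.extend fun m hm hmk ↦ colValid_of_checkTableCol (prm := prm) (by norm_num [prm]) (not_not.mp a_posb) (not_not.mp consts_validb) tC830 hm hmk
  have h850 : TabColValid (2 ^ 256) a ks 160 (840 + 10) ctab :=
    h840.extend fun m hm hmk ↦ colValid_of_checkTableCol (prm := prm) (by norm_num [prm]) (not_not.mp a_posb) (not_not.mp consts_validb) tC840 hm hmk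
  have h860 : TabColValid (2 ^ 256) a ks 160 (850 + 10) ctab :=
    h850.extend fun m hm hmk ↦ colValid_of_checkTableCol (prm := prm) (by norm_num [prm]) (not_not.mp a_posb) (not_not.mp consts_validb) tC850 hm hmk
  have h870 : TabColValid (2 ^ 256) a ks 160 (860 + 10) ctab :=
    h860.extend fun m hm hmk ↦ colValid_of_checkTableCol (prm := prm) (by norm_num [prm]) (not_not.mp a_posb) (not_not.mp consts_validb) tC860 hm hmk
  have h880 : TabColValid (2 ^ 256) a ks 160 (870 + 10) ctab :=
    h870.extend fun m hm hmk ↦ colValid_of_checkTableCol (prm := prm) (by norm_num [prm]) (not_not.mp a_posb) (not_not.mp consts_validb) tC870 hm hmk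
  have h890 : TabColValid (2 ^ 256) a ks 160 (880 + 10) ctab :=
    h880.extend fun m hm hmk ↦ colValid_of_checkTableCol (prm := prm) (by norm_num [prm]) (not_not.mp a_posb) (not_not.mp consts_validb) tC880 hm hmk
  have h900 : TabColValid (2 ^ 256) a ks 160 (890 + 10) ctab :=
    h890.extend fun m hm hmk ↦ colValid_of_checkTableCol (prm := prm) (by norm_num [prm]) (not_not.mp a_posb) (not_not.mp consts_validb) tC890 hm hmk
  have h910 : TabColValid (2 ^ 256) a ks 160 (900 + 10) ctab :=
    h900.extend fun m hm hmk ↦ colValid_of_checkTableCol (prm := prm) (by norm_num [prm]) (not_not.mp a_posb) (not_not.mp consts_validb) tC900 hm hmk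
  have h920 : TabColValid (2 ^ 256) a ks 160 (910 + 10) ctab :=
    h910.extend fun m hm hmk ↦ colValid_of_checkTableCol (prm := prm) (by norm_num [prm]) (not_not.mp a_posb) (not_not.mp consts_validb) tC910 hm hmk
  have h930 : TabColValid (2 ^ 256) a ks 160 (920 + 10) ctab :=
    h920.extend fun m hm hmk ↦ colValid_of_checkTableCol (prm := prm) (by norm_num [prm]) (not_not.mp a_posb) (not_not.mp consts_validb) tC920 hm hmk
  have h940 : TabColValid (2 ^ 256) a ks 160 (930 + 10) ctab :=
    h930.extend fun m hm hmk ↦ colValid_of_checkTableCol (prm := prm) (by norm_num [prm]) (not_not.mp a_posb) (not_not.mp consts_validb) tC930 hm hmk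
  have h950 : TabColValid (2 ^ 256) a ks 160 (940 + 10) ctab :=
    h940.extend fun m hm hmk ↦ colValid_of_checkTableCol (prm := prm) (by norm_num [prm]) (not_not.mp a_posb) (not_not.mp consts_validb) tC940 hm hmk
  have h960 : TabColValid (2 ^ 256) a ks 160 (950 + 10) ctab :=
    h950.extend fun m hm hmk ↦ colValid_of_checkTableCol (prm := prm) (by norm_num [prm]) (not_not.mp a_posb) (not_not.mp consts_validb) tC950 hm hmk
  have h970 : TabColValid (2 ^ 256) a ks 160 (960 + 10) ctab :=
    h960.extend fun m hm hmk ↦ colValid_of_checkTableCol (prm := prm) (by norm_num [prm]) (not_not.mp a_posb) (not_not.mp consts_validb) tC960 hm hmk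
  have h980 : TabColValid (2 ^ 256) a ks 160 (970 + 10) ctab :=
    h970.extend fun m hm hmk ↦ colValid_of_checkTableCol (prm := prm) (by norm_num [prm]) (not_not.mp a_posb) (not_not.mp consts_validb) tC970 hm hmk
  have h990 : TabColValid (2 ^ 256) a ks 160 (980 + 10) ctab :=
    h980.extend fun m hm hmk ↦ colValid_of_checkTableCol (prm := prm) (by norm_num [prm]) (not_not.mp a_posb) (not_not.mp consts_validb) tC980 hm hmk
  have h1000 : TabColValid (2 ^ 256) a ks 160 (990 + 10) ctab :=
    h990.extend fun m hm hmk ↦ colValid_of_checkTableCol (prm := prm) (by norm_num [prm]) (not_not.mp a_posb) (not_not.mp consts_validb) tC990 hm hmk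
  have h1010 : TabColValid (2 ^ 256) a ks 160 (1000 + 10) ctab :=
    h1000.extend fun m hm hmk ↦ colValid_of_checkTableCol (prm := prm) (by norm_num [prm]) (not_not.mp a_posb) (not_not.mp consts_validb) tC1000 hm hmk
  have h1020 : TabColValid (2 ^ 256) a ks 160 (1010 + 10) ctab :=
    h1010.extend fun m hm hmk ↦ colValid_of_checkTableCol (prm := prm) (by norm_num [prm]) (not_not.mp a_posb) (not_not.mp consts_validb) tC1010 hm hmk
  have h1027 : TabColValid (2 ^ 256) a ks 160 (1020 + 7) ctab :=
    h1020.extend fun m hm hmk ↦ colValid_of_checkTableCol (prm := prm) (by norm_num [prm]) (not_not.mp a_posb) (not_not.mp consts_validb) tC1020 hm hmk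
  exact h1027

end Summit.RiemannHypothesis.RiemannHypothesis.Theorems.WeilFormatCData.O94

-- ===== from WeilFormatCDataO94Front =====
namespace Summit.RiemannHypothesis.RiemannHypothesis.Theorems.WeilFormatCData.O94
open Literature.NumberTheory.LFunctions Literature.NumberTheory.LFunctions.Yoshida1992 Encl Literature.Analysis.ValidatedNumerics.NumericsMP

/-- odd column range (kit form). -/
theorem ctab_valid_odd : TabColValid (2 ^ 256) O94.a O94.ks 160 (1024 + 2) O94.ctab :=
  fun m hm hmk ↦ ctab_valid m (by omega) (by omega)

/-- odd column range (column-data form). -/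
theorem ctab_valid_oddK : TabColValid (2 ^ 256) O94.a O94.ks 160 (160 + 160 + 1) O94.ctab :=
  fun m hm hmk ↦ ctab_valid m (by omega) (by omega)

/-- the front-door constants are valid for `a`. -/
theorem fd_valid : FDValid (2 ^ 256) O94.a O94.F :=
  fdValid_of_check (prm := prm) (ks := ks) (by norm_num [prm]) (not_not.mp primeDatab) (not_not.mp consts_validb) tFb.symm

/-- `FA` is valid with the certified prime constant `A = 1825/1000` plus the margin μ = 2^-75. -/
theorem fdA_valid : FDValidA (2 ^ 256) O94.a (((344732753249484100599813 : ℤ) : ℝ) / (188894659314785808547840 : ℕ)) O94.FA :=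
  fd_valid.withFrac 344732753249484100599813 (by norm_num)

/-- λ-run: `FA` is valid with `A + 2·lam`, `lam = lamZ·2^-250`, `lamZ = 23945242826029513411849172299223580994042798784118784` (the shape the odd λ-door reads). -/
theorem fdA_valid_shift : FDValidA (2 ^ 256) O94.a (((1825 : ℤ) : ℝ) / (1000 : ℕ) + 2 * ((((2 ^ 174 : ℤ) : ℤ) : ℝ) * (1 / 2 ^ 250))) O94.FA := by
  convert fdA_valid using 2
  push_cast
  norm_num

/-- kernel (assembled from the eight bands of 108, `WeilFormatCData.A1.wvBands_range_of_bands4`): odd reciprocal column weights against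
the arctan far diagonal, all 864 columns, square-root minorants `A1CBOdd.rsW / 1099512676352` (weil-2's non-dyadic minorants of the
identical `160/1024` geometry), weights unpacked once (`vw_eq_vwL`). -/
theorem tWvO : checkWeightsOddV (2 ^ 256) 150 O94.C O94.FA O94.ctab 160 864 64 O94CBOdd.vw A1CBOdd.rsW 1099512676352 234470 1048576 = true := by
  rw [show checkWeightsOddV (2 ^ 256) 150 O94.C O94.FA O94.ctab 160 864 64 O94CBOdd.vw A1CBOdd.rsW 1099512676352 234470 1048576
      = (List.range 864).all (fun t ↦
      decide (0 < O94CBOdd.vw.getD t 0) && checkSqrtLower 160 (160 + t + 1) (A1CBOdd.rsW.getD t 0) 1099512676352 &&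
        match devOddABox (2 ^ 256) 150 O94.C O94.FA (tget O94.ctab (160 + t + 1)) (160 + t) 160 (A1CBOdd.rsW.getD t 0) 1099512676352 234470 1048576 with
        | some Y => decide ((2 ^ 64 : ℤ) * ((2 ^ 256 : ℕ) : ℤ) ≤ (O94CBOdd.vw.getD t 0 : ℤ) * Y.lo)
        | none => false) from rfl, vw_eq_vwL]
  exact WeilFormatCData.A1.wvBands_range_of_bands4 (a := 216) (b := 216) (c := 216) (d := 216)
    (S2FormatC.E0.band_append (n₀ := 0) (k := 108) (k' := 108) tWvOb0 tWvOb108)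
    (S2FormatC.E0.band_append (n₀ := 216) (k := 108) (k' := 108) tWvOb216 tWvOb324)
    (S2FormatC.E0.band_append (n₀ := 432) (k := 108) (k' := 108) tWvOb432 tWvOb540)
    (S2FormatC.E0.band_append (n₀ := 648) (k := 108) (k' := 108) tWvOb648 tWvOb756)

/-- the mean-square tail's sine hypotheses for `s = sFun sd1 csd`, `sFun2 sdm csd`, `sFun2 sdp csd` (window written out once). -/
theorem sines :
    (∀ k ∈ weilPrimeIndex O94.a, IsPrimePow k → 0 ≤ sFun O94.sd1 O94.csd k ∧ sFun O94.sd1 O94.csd k ≤ |Real.sin (Real.pi * Real.log k / (((47 : ℤ) : ℝ) / (50 : ℕ)) / 2)|) ∧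
    (∀ k ∈ weilPrimeIndex O94.a, ∀ k' ∈ weilPrimeIndex O94.a, IsPrimePow k → IsPrimePow k' → k ≠ k' →
      0 ≤ sFun2 O94.sdm O94.csd k k' ∧ sFun2 O94.sdm O94.csd k k' ≤ |Real.sin ((Real.pi * Real.log k / O94.a - Real.pi * Real.log k' / O94.a) / 2)|) ∧
    (∀ k ∈ weilPrimeIndex O94.a, ∀ k' ∈ weilPrimeIndex O94.a, IsPrimePow k → IsPrimePow k' →
      0 ≤ sFun2 O94.sdp O94.csd k k' ∧ sFun2 O94.sdp O94.csd k k' ≤ |Real.sin ((Real.pi * Real.log k / O94.a + Real.pi * Real.log k' / O94.a) / 2)|) :=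
  sines_of_check (prm := prm) (by norm_num [prm]) (not_not.mp primeDatab) (not_not.mp consts_validb) tSinesb.symm

end Summit.RiemannHypothesis.RiemannHypothesis.Theorems.WeilFormatCData.O94

-- ===== from WeilFormatCDataO94Mid =====
namespace Summit.RiemannHypothesis.RiemannHypothesis.Theorems.WeilFormatCData.O94
open Literature.NumberTheory.LFunctions Literature.NumberTheory.LFunctions.Yoshida1992 Encl Literature.Analysis.ValidatedNumerics.NumericsMP

/-- the odd middle moment record is valid (light table on the middle range; `B₄` as a literal). -/
theorem momO_valid : MidMomValidO (2 ^ 256) O94.a (wvF (O94CBOdd.vw.drop 160) 64 320) 320 1024 4 O94.momO := by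
  have h : MidMomValidO (2 ^ 256) a (wvF (O94CBOdd.vw.drop 160) 64 320) 320 (320 + 704) 4 (midMomO (2 ^ 256) C ctab 64 (O94CBOdd.vw.drop 160) 320 704 4) :=
    midMomO_valid (S := 2 ^ 256) (by norm_num) (not_not.mp primeDatab) (not_not.mp consts_validb) (fun m hm hmk ↦ ctab_valid m (by omega) (by omega)) 4
  rw [show (320 + 704 : ℕ) = 1024 from rfl] at h
  exact ⟨fun j hj j' hj' ↦ by rw [tMomO_AA]; exact h.AA j hj j' hj', fun j hj r hr ↦ by rw [tMomO_AB]; exact h.AB j hj r hr,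
    fun r hr j hj ↦ by rw [tMomO_BA]; exact h.BA r hr j hj, fun r hr r' hr' ↦ by rw [tMomO_BB]; exact h.BB r hr r' hr', by rw [tMomO_sm]; exact h.sm⟩

end Summit.RiemannHypothesis.RiemannHypothesis.Theorems.WeilFormatCData.O94

-- ===== from WeilFormatCDataO94CBOddCols0 =====
namespace Summit.RiemannHypothesis.RiemannHypothesis.Theorems.WeilFormatCData.O94CBOdd
open Literature.NumberTheory.LFunctions Literature.NumberTheory.LFunctions.Yoshida1992 Encl Literature.Analysis.ValidatedNumerics.NumericsMP
open Summit.RiemannHypothesis.RiemannHypothesis.Theorems.WeilFormatCData.O94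

/-- column data certified below row `35`. -/
theorem colData35 : DataNear (fun i t ↦ sectorKernel true (gramCoeff O94.a) i (160 + t)) 35 160 127 (2 ^ (127 - 1)) 124 O94CBOdd.ρc O94CBOdd.XP := by
  have hT := tab_valid_odd
  have hCT := ctab_valid_oddK
  have h0 : DataNear (fun i t ↦ sectorKernel true (gramCoeff a) i (160 + t)) 0 160 127 (2 ^ (127 - 1)) 124 ρc XP := DataNear.zeroRows
  have h5 : DataNear (fun i t ↦ sectorKernel true (gramCoeff a) i (160 + t)) (0 + 5) 160 127 (2 ^ (127 - 1)) 124 ρc XP :=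
    colDataNear_extendRows (S := 2 ^ 256) (by norm_num) (not_not.mp a_posb) (not_not.mp primeDatab) (not_not.mp consts_validb) (by norm_num : 1 ≤ 160) hT hCT true (by norm_num) rfl h0 tCol0
  have h10 : DataNear (fun i t ↦ sectorKernel true (gramCoeff a) i (160 + t)) (5 + 5) 160 127 (2 ^ (127 - 1)) 124 ρc XP :=
    colDataNear_extendRows (S := 2 ^ 256) (by norm_num) (not_not.mp a_posb) (not_not.mp primeDatab) (not_not.mp consts_validb) (by norm_num : 1 ≤ 160) hT hCT true (by norm_num) rfl h5 tCol5
  have h15 : DataNear (fun i t ↦ sectorKernel true (gramCoeff a) i (160 + t)) (10 + 5) 160 127 (2 ^ (127 - 1)) 124 ρc XP :=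
    colDataNear_extendRows (S := 2 ^ 256) (by norm_num) (not_not.mp a_posb) (not_not.mp primeDatab) (not_not.mp consts_validb) (by norm_num : 1 ≤ 160) hT hCT true (by norm_num) rfl h10 tCol10
  have h20 : DataNear (fun i t ↦ sectorKernel true (gramCoeff a) i (160 + t)) (15 + 5) 160 127 (2 ^ (127 - 1)) 124 ρc XP :=
    colDataNear_extendRows (S := 2 ^ 256) (by norm_num) (not_not.mp a_posb) (not_not.mp primeDatab) (not_not.mp consts_validb) (by norm_num : 1 ≤ 160) hT hCT true (by norm_num) rfl h15 tCol15
  have h25 : DataNear (fun i t ↦ sectorKernel true (gramCoeff a) i (160 + t)) (20 + 5) 160 127 (2 ^ (127 - 1)) 124 ρc XP :=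
    colDataNear_extendRows (S := 2 ^ 256) (by norm_num) (not_not.mp a_posb) (not_not.mp primeDatab) (not_not.mp consts_validb) (by norm_num : 1 ≤ 160) hT hCT true (by norm_num) rfl h20 tCol20
  have h30 : DataNear (fun i t ↦ sectorKernel true (gramCoeff a) i (160 + t)) (25 + 5) 160 127 (2 ^ (127 - 1)) 124 ρc XP :=
    colDataNear_extendRows (S := 2 ^ 256) (by norm_num) (not_not.mp a_posb) (not_not.mp primeDatab) (not_not.mp consts_validb) (by norm_num : 1 ≤ 160) hT hCT true (by norm_num) rfl h25 tCol25
  have h35 : DataNear (fun i t ↦ sectorKernel true (gramCoeff a) i (160 + t)) (30 + 5) 160 127 (2 ^ (127 - 1)) 124 ρc XP :=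
    colDataNear_extendRows (S := 2 ^ 256) (by norm_num) (not_not.mp a_posb) (not_not.mp primeDatab) (not_not.mp consts_validb) (by norm_num : 1 ≤ 160) hT hCT true (by norm_num) rfl h30 tCol30
  exact h35

end Summit.RiemannHypothesis.RiemannHypothesis.Theorems.WeilFormatCData.O94CBOdd

-- ===== from WeilFormatCDataO94CBOddCols1 =====
namespace Summit.RiemannHypothesis.RiemannHypothesis.Theorems.WeilFormatCData.O94CBOdd
open Literature.NumberTheory.LFunctions Literature.NumberTheory.LFunctions.Yoshida1992 Encl Literature.Analysis.ValidatedNumerics.NumericsMP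
open Summit.RiemannHypothesis.RiemannHypothesis.Theorems.WeilFormatCData.O94

/-- column data certified below row `70`. -/
theorem colData70 : DataNear (fun i t ↦ sectorKernel true (gramCoeff O94.a) i (160 + t)) 70 160 127 (2 ^ (127 - 1)) 124 O94CBOdd.ρc O94CBOdd.XP := by
  have hT := tab_valid_odd
  have hCT := ctab_valid_oddK
  have h35 := colData35
  have h40 : DataNear (fun i t ↦ sectorKernel true (gramCoeff a) i (160 + t)) (35 + 5) 160 127 (2 ^ (127 - 1)) 124 ρc XP :=
    colDataNear_extendRows (S := 2 ^ 256) (by norm_num) (not_not.mp a_posb) (not_not.mp primeDatab) (not_not.mp consts_validb) (by norm_num : 1 ≤ 160) hT hCT true (by norm_num) rfl h35 tCol35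
  have h45 : DataNear (fun i t ↦ sectorKernel true (gramCoeff a) i (160 + t)) (40 + 5) 160 127 (2 ^ (127 - 1)) 124 ρc XP :=
    colDataNear_extendRows (S := 2 ^ 256) (by norm_num) (not_not.mp a_posb) (not_not.mp primeDatab) (not_not.mp consts_validb) (by norm_num : 1 ≤ 160) hT hCT true (by norm_num) rfl h40 tCol40
  have h50 : DataNear (fun i t ↦ sectorKernel true (gramCoeff a) i (160 + t)) (45 + 5) 160 127 (2 ^ (127 - 1)) 124 ρc XP :=
    colDataNear_extendRows (S := 2 ^ 256) (by norm_num) (not_not.mp a_posb) (not_not.mp primeDatab) (not_not.mp consts_validb) (by norm_num : 1 ≤ 160) hT hCT true (by norm_num) rfl h45 tCol45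
  have h55 : DataNear (fun i t ↦ sectorKernel true (gramCoeff a) i (160 + t)) (50 + 5) 160 127 (2 ^ (127 - 1)) 124 ρc XP :=
    colDataNear_extendRows (S := 2 ^ 256) (by norm_num) (not_not.mp a_posb) (not_not.mp primeDatab) (not_not.mp consts_validb) (by norm_num : 1 ≤ 160) hT hCT true (by norm_num) rfl h50 tCol50
  have h60 : DataNear (fun i t ↦ sectorKernel true (gramCoeff a) i (160 + t)) (55 + 5) 160 127 (2 ^ (127 - 1)) 124 ρc XP :=
    colDataNear_extendRows (S := 2 ^ 256) (by norm_num) (not_not.mp a_posb) (not_not.mp primeDatab) (not_not.mp consts_validb) (by norm_num : 1 ≤ 160) hT hCT true (by norm_num) rfl h55 tCol55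
  have h65 : DataNear (fun i t ↦ sectorKernel true (gramCoeff a) i (160 + t)) (60 + 5) 160 127 (2 ^ (127 - 1)) 124 ρc XP :=
    colDataNear_extendRows (S := 2 ^ 256) (by norm_num) (not_not.mp a_posb) (not_not.mp primeDatab) (not_not.mp consts_validb) (by norm_num : 1 ≤ 160) hT hCT true (by norm_num) rfl h60 tCol60
  have h70 : DataNear (fun i t ↦ sectorKernel true (gramCoeff a) i (160 + t)) (65 + 5) 160 127 (2 ^ (127 - 1)) 124 ρc XP :=
    colDataNear_extendRows (S := 2 ^ 256) (by norm_num) (not_not.mp a_posb) (not_not.mp primeDatab) (not_not.mp consts_validb) (by norm_num : 1 ≤ 160) hT hCT true (by norm_num) rfl h65 tCol65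
  exact h70

end Summit.RiemannHypothesis.RiemannHypothesis.Theorems.WeilFormatCData.O94CBOdd
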